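import Literature.Barriers.ResolutionOfSingularities.QuasiExcellenceNecessary
import Literature.AlgebraicGeometry.Resolution.OneDimAnalyticallyUnramifiedFinite
import HarnessLib

/-!
# Discharge of `Krull1930_Kollar_1_101` (Krull's criterion, Kollár Thm. 1.101 (2) ⇔ (3))

`Literature/Barriers/ResolutionOfSingularities/QuasiExcellenceNecessaryKrullProofs.lean` —
sibling proof file of `QuasiExcellenceNecessary.lean`: DISCHARGES its named fact
`Literature.Barriers.ResolutionOfSingularities.QuasiExcellence.Krull1930_Kollar_1_101`
(Kollár, *Lectures on Resolution of Singularities*, §1.13, **Theorem 1.101** [Kru30, Satz 7],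
the equivalence (2) ⇔ (3) in the case of a one-dimensional Noetherian local DOMAIN `R`: the
normalization `R̄` is a finite `R`-module iff the `𝔪`-adic completion `R̂` is reduced) —
`Krull1930_Kollar_1_101_holds` (the other named fact of that file,
`Nagata1962_nonFiniteNormalization`, is discharged in `QuasiExcellenceNecessaryNagataProofs.lean`).

## The proof

All the work is in `Literature/AlgebraicGeometry/Resolution/OneDimAnalyticallyUnramified.lean`
and `OneDimAnalyticallyUnramifiedFinite.lean`
(`Literature.AlgebraicGeometry.Resolution.module_finite_integralClosure_iff_isReduced_adicCompletion`),
which follow Kollár's proof of Theorem 1.101 (p. 59 of the book):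

* **(2) ⇒ (3)** as printed (fourth step of Kollár's proof): `R̄` finite ⇒ `R̄` is a Dedekind
  domain, the completion of the semi-local ring `R̄` is `R̄ ⊗_R R̂ ≅ Π_𝔫 (R̄_𝔫)^`, each factor the
  completion of a DVR, hence a complete regular local ring, hence a domain; and `R̂ ↪ R̄ ⊗_R R̂`
  (Artin–Rees / flatness of `R̂`), so `R̂` is reduced.
* **(3) ⇒ (2)** (fifth step): Kollár obtains (2) for `R̂` from Nagata's finiteness of the
  normalization of complete local domains (his Theorem 1.102, the tree's
  `module_finite_integralClosure_of_complete`) and descends to `R` through the blow-up sequence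
  (1); the blow-up algorithm 1.100 not being formalised, the descent `R̂ ⇝ R` is done instead by
  a conductor argument along the faithfully flat map `R → R̂` (a power of any `x ∈ 𝔪_R ∖ 0`
  conducts `R̄` into `R`, so `R̄` embeds in a cyclic `R`-module).

## Sources

* J. Kollár, *Lectures on Resolution of Singularities*, Ann. of Math. Stud. 166, Princeton
  2007, §1.13, Thm. 1.101 (statement and proof), Thm. 1.102, Example 1.103. [Kollar2007]
* W. Krull, *Ein Satz über primäre Integritätsbereiche*, Math. Ann. 103 (1930) 450–465,
  Satz 7 (as cited by Kollár, [Kru30]).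
-/

noncomputable section

open IsLocalRing Literature.AlgebraicGeometry.Resolution

namespace Literature.Barriers.ResolutionOfSingularities

namespace QuasiExcellence

/-- DISCHARGE of the named fact `Krull1930_Kollar_1_101` — **Krull's criterion (Kollár
Thm. 1.101 (2) ⇔ (3), [Kru30, Satz 7]), local domain case**: for a one-dimensional Noetherian
local domain `R`, the normalization of `R` is a finite `R`-module iff the `𝔪`-adic completion
`R̂` is reduced. Immediate from
`Literature.AlgebraicGeometry.Resolution.module_finite_integralClosure_iff_isReduced_adicCompletion`.
[cite: Kollar2007, Thm. 1.101] -/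
theorem Krull1930_Kollar_1_101_holds : Krull1930_Kollar_1_101 := by
  intro R _ _ _ _ hdim
  exact module_finite_integralClosure_iff_isReduced_adicCompletion R hdim

end QuasiExcellence

end Literature.Barriers.ResolutionOfSingularities

end
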